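import Summits.Parity.BatemanHorn.Theorems.RoughValueTransportBalancedSemiprimeLayerDegreeLeTwo
import HarnessLib

/-!
# Route `RoughValueTransport`, crux `BalancedSemiprimeLayer` (stmt-Parity-9469), line
# `smooth-modulus-twisted-hooley`: the DEGREE SPLIT of the crux, by name and fully unfolded

The line has landed every stub except its residual `stub_higherLayer` (coordinates of degree `≥ 3`),
and `…DegreeLeTwo` proves `BalancedSemiprimeLayer ↔ (∀ systems, ∀ coordinates of degree ≥ 3,
CoordLayerThin f i)`.  This file is the planner-facing HANDOFF for promoting that stub to the route's
foreseen split items `LayerLinear → LayerQuadratic → LayerHigher → BalancedSemiprimeLayer`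
(TWO-LAYER PLAN of the route docstring):

* `Split.coordLayerThin_of_natDegree_eq_two` / `_le_two` — `CoordLayerThin f i` BY NAME for every
  coordinate of degree `2`, `≤ 2` of ANY Bateman–Horn system (the other coordinates may have any
  degrees; degree `1` by name is the landed `stub_linearLayer` itself): `LayerLinear` and
  `LayerQuadratic` in coordinate form, unconditional;
* `Split.layerLinear_unfolded`, `Split.layerQuadratic_unfolded` — the same two statements with
  `CoordLayerThin`/`coordLayer` UNFOLDED into route-file vocabulary (only `Mathlib` + `Literature`
  names), so that a Theses item filed with this text closes `--by` these theorems;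
* `Split.balancedSemiprimeLayer_iff_higherLayer_unfolded` (and the two directions
  `balancedSemiprimeLayer_of_higherLayer_unfolded`, `higherLayer_unfolded_of_balancedSemiprimeLayer`)
  — the crux is EQUIVALENT to the fully unfolded degree-`≥ 3` statement: the verbatim signature for
  `LayerHigher`;
* `stub_degreeSplit` — the skeleton's registered split-glue stub, PROVED:
  `LayerLinear → LayerQuadratic → LayerHigher → BalancedSemiprimeLayer` with all three hypotheses in
  unfolded form (the glue item of the split, closable at once `--by` it).

Everything is a one-line composition of LANDED theorems (`stub_linearLayer` p73627,
`stub_twistedHooley` p74670, `stub_uniformTypeI` p74271, `stub_quadraticDictionary` p72470,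
`stub_quadraticSieve` p76614, `DegreeLeTwo.coordLayerThin_quadratic_of_parts`, `stub_transfer`,
`Negative.higherLayer_of_balancedSemiprimeLayer` p75295); the unfolded forms hold by `δ`-reduction of
`CoordLayerThin` / `coordLayer` (`Theorems/RoughValueTransportDefs.lean`).
-/

namespace Summit.Parity.BatemanHorn.Cruxes.BalancedSemiprimeLayer.SmoothModulusTwistedHooley

open Polynomial Filter Finset
open Literature.NumberTheory.Sieve
open Summit.Parity.BatemanHorn.Theorems.BalancedSemiprimeLayer.Negative
  (natDegree_pos_of_isBatemanHornSystem higherLayer_of_balancedSemiprimeLayer)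
open Summit.Parity.BatemanHorn.Theses.RoughValueTransport (BalancedSemiprimeLayer)

namespace Split

/-! ### `LayerLinear`, `LayerQuadratic` in coordinate form, by name -/

/-- **`LayerQuadratic` (coordinate form)**: every coordinate of degree `2` of a Bateman–Horn system
has a thin rough-composite layer — the twisted Hooley lever (`stub_twistedHooley`) feeds uniform
Type-I information (`stub_uniformTypeI`) into the `(k+1)`-dimensional sieve on the relaxed divisor
family (`stub_quadraticDictionary`, `stub_quadraticSieve`), composed by
`DegreeLeTwo.coordLayerThin_quadratic_of_parts`.  Unconditional. [folklore] -/
theorem coordLayerThin_of_natDegree_eq_two :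
    ∀ (k : ℕ) (f : Fin k → ℤ[X]), IsBatemanHornSystem f →
      ∀ i : Fin k, (f i).natDegree = 2 → CoordLayerThin f i :=
  fun k f hf i hi =>
    DegreeLeTwo.coordLayerThin_quadratic_of_parts stub_quadraticDictionary stub_quadraticSieve
      k f hf i hi
      (stub_uniformTypeI (f i) hi (hf.irreducible i) (stub_twistedHooley (f i) hi (hf.irreducible i)))

/-- **Every coordinate of degree `≤ 2` of a Bateman–Horn system has a thin layer** (degree `0` cannot
occur: `Negative.natDegree_pos_of_isBatemanHornSystem`). [folklore] -/
theorem coordLayerThin_of_natDegree_le_two :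
    ∀ (k : ℕ) (f : Fin k → ℤ[X]), IsBatemanHornSystem f →
      ∀ i : Fin k, (f i).natDegree ≤ 2 → CoordLayerThin f i := by
  intro k f hf i hi
  have hpos := natDegree_pos_of_isBatemanHornSystem hf i
  rcases Nat.lt_or_ge (f i).natDegree 2 with hlt | hge
  · exact stub_linearLayer k f hf i (by omega)
  · exact coordLayerThin_of_natDegree_eq_two k f hf i (le_antisymm hi hge)

/-- **The degree trichotomy for one system**: if the coordinates of degree `≥ 3` of the Bateman–Horn
system `f` have thin layers, then EVERY coordinate of `f` has. [folklore] -/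
theorem coordLayerThin_of_higherLayer_system {k : ℕ} {f : Fin k → ℤ[X]} (hf : IsBatemanHornSystem f)
    (hhigh : ∀ i : Fin k, 3 ≤ (f i).natDegree → CoordLayerThin f i) (i : Fin k) :
    CoordLayerThin f i := by
  rcases Nat.lt_or_ge (f i).natDegree 3 with hlt | hge
  · exact coordLayerThin_of_natDegree_le_two k f hf i (by omega)
  · exact hhigh i hge

/-! ### The same statements UNFOLDED into route-file vocabulary

`CoordLayerThin f i` and `coordLayer f i δ x` (`Theorems/RoughValueTransportDefs.lean`) are plain
definitions; a Theses item cannot import them, so the split items must be filed with the text below.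
Each unfolded theorem is the folded one re-typed (definitional unfolding only). -/

/-- **`LayerLinear`, unfolded** (file this text as the item; it closes `--by` this theorem): for every
Bateman–Horn system `f` of `k` polynomials, every coordinate `i` of degree `1` and every `ε > 0` there
is `δ ∈ (0, 1/4]` with, eventually in `x`,
`#{1 ≤ n ≤ x : every fⱼ(n) > 0 and free of primes < x^{deg fⱼ(1−δ)/2}, and fᵢ(n) not prime} ≤ εx/(log x)^k`.
[folklore] -/
theorem layerLinear_unfolded :
    ∀ (k : ℕ) (f : Fin k → Polynomial ℤ), Literature.NumberTheory.Sieve.IsBatemanHornSystem f →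
      ∀ i : Fin k, (f i).natDegree = 1 → ∀ ε : ℝ, 0 < ε → ∃ δ : ℝ, 0 < δ ∧ δ ≤ 1 / 4 ∧
        ∀ᶠ x : ℕ in Filter.atTop,
          (((Finset.Icc 1 x).filter (fun n : ℕ => (∀ j, 0 < (f j).eval (n : ℤ) ∧
              ∀ p ∈ Finset.range ⌈(x : ℝ) ^ (((f j).natDegree : ℝ) * (1 - δ) / 2)⌉₊,
                p.Prime → ¬ ((p : ℤ) ∣ (f j).eval (n : ℤ))) ∧
              ¬ ((f i).eval (n : ℤ)).toNat.Prime)).card : ℝ) ≤ ε * (x : ℝ) / Real.log x ^ k :=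
  stub_linearLayer

/-- **`LayerQuadratic`, unfolded** (file this text as the item; it closes `--by` this theorem): the
same conclusion for every coordinate of degree `2`. [folklore] -/
theorem layerQuadratic_unfolded :
    ∀ (k : ℕ) (f : Fin k → Polynomial ℤ), Literature.NumberTheory.Sieve.IsBatemanHornSystem f →
      ∀ i : Fin k, (f i).natDegree = 2 → ∀ ε : ℝ, 0 < ε → ∃ δ : ℝ, 0 < δ ∧ δ ≤ 1 / 4 ∧
        ∀ᶠ x : ℕ in Filter.atTop,
          (((Finset.Icc 1 x).filter (fun n : ℕ => (∀ j, 0 < (f j).eval (n : ℤ) ∧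
              ∀ p ∈ Finset.range ⌈(x : ℝ) ^ (((f j).natDegree : ℝ) * (1 - δ) / 2)⌉₊,
                p.Prime → ¬ ((p : ℤ) ∣ (f j).eval (n : ℤ))) ∧
              ¬ ((f i).eval (n : ℤ)).toNat.Prime)).card : ℝ) ≤ ε * (x : ℝ) / Real.log x ^ k :=
  coordLayerThin_of_natDegree_eq_two

/-- **`LayerHigher`, unfolded, implies the crux** (the glue direction; `stub_transfer` re-typed):
file `LayerHigher` with exactly the hypothesis text. [folklore] -/
theorem balancedSemiprimeLayer_of_higherLayer_unfolded :
    (∀ (k : ℕ) (f : Fin k → Polynomial ℤ), Literature.NumberTheory.Sieve.IsBatemanHornSystem f →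
      ∀ i : Fin k, 3 ≤ (f i).natDegree → ∀ ε : ℝ, 0 < ε → ∃ δ : ℝ, 0 < δ ∧ δ ≤ 1 / 4 ∧
        ∀ᶠ x : ℕ in Filter.atTop,
          (((Finset.Icc 1 x).filter (fun n : ℕ => (∀ j, 0 < (f j).eval (n : ℤ) ∧
              ∀ p ∈ Finset.range ⌈(x : ℝ) ^ (((f j).natDegree : ℝ) * (1 - δ) / 2)⌉₊,
                p.Prime → ¬ ((p : ℤ) ∣ (f j).eval (n : ℤ))) ∧
              ¬ ((f i).eval (n : ℤ)).toNat.Prime)).card : ℝ) ≤ ε * (x : ℝ) / Real.log x ^ k) →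
      BalancedSemiprimeLayer :=
  stub_transfer

/-- **The crux implies `LayerHigher`, unfolded** (the disprover's
`Negative.higherLayer_of_balancedSemiprimeLayer` re-typed): promoting the stub loses nothing. [folklore] -/
theorem higherLayer_unfolded_of_balancedSemiprimeLayer :
    BalancedSemiprimeLayer →
      ∀ (k : ℕ) (f : Fin k → Polynomial ℤ), Literature.NumberTheory.Sieve.IsBatemanHornSystem f →
        ∀ i : Fin k, 3 ≤ (f i).natDegree → ∀ ε : ℝ, 0 < ε → ∃ δ : ℝ, 0 < δ ∧ δ ≤ 1 / 4 ∧
          ∀ᶠ x : ℕ in Filter.atTop,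
            (((Finset.Icc 1 x).filter (fun n : ℕ => (∀ j, 0 < (f j).eval (n : ℤ) ∧
                ∀ p ∈ Finset.range ⌈(x : ℝ) ^ (((f j).natDegree : ℝ) * (1 - δ) / 2)⌉₊,
                  p.Prime → ¬ ((p : ℤ) ∣ (f j).eval (n : ℤ))) ∧
                ¬ ((f i).eval (n : ℤ)).toNat.Prime)).card : ℝ) ≤ ε * (x : ℝ) / Real.log x ^ k :=
  higherLayer_of_balancedSemiprimeLayer

/-- **The crux is EQUIVALENT to `LayerHigher` (unfolded)** — `balancedSemiprimeLayer_iff_higherLayer`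
re-typed in route-file vocabulary: the right-hand side is the verbatim signature to file for the
promoted stub `stub_higherLayer`. [folklore] -/
theorem balancedSemiprimeLayer_iff_higherLayer_unfolded :
    BalancedSemiprimeLayer ↔
      ∀ (k : ℕ) (f : Fin k → Polynomial ℤ), Literature.NumberTheory.Sieve.IsBatemanHornSystem f →
        ∀ i : Fin k, 3 ≤ (f i).natDegree → ∀ ε : ℝ, 0 < ε → ∃ δ : ℝ, 0 < δ ∧ δ ≤ 1 / 4 ∧
          ∀ᶠ x : ℕ in Filter.atTop,
            (((Finset.Icc 1 x).filter (fun n : ℕ => (∀ j, 0 < (f j).eval (n : ℤ) ∧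
                ∀ p ∈ Finset.range ⌈(x : ℝ) ^ (((f j).natDegree : ℝ) * (1 - δ) / 2)⌉₊,
                  p.Prime → ¬ ((p : ℤ) ∣ (f j).eval (n : ℤ))) ∧
                ¬ ((f i).eval (n : ℤ)).toNat.Prime)).card : ℝ) ≤ ε * (x : ℝ) / Real.log x ^ k :=
  ⟨higherLayer_unfolded_of_balancedSemiprimeLayer, balancedSemiprimeLayer_of_higherLayer_unfolded⟩


end Split

/-! ### The registered split-glue stub, by name -/

/-- **stub_degreeSplit** — the registered split-glue stub of the skeleton
`Cruxes/BalancedSemiprimeLayer/Lines/smooth-modulus-twisted-hooley.lean` (reshape r2), PROVED: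
`LayerLinear → LayerQuadratic → LayerHigher → BalancedSemiprimeLayer` with the three hypotheses in
the unfolded texts above and the crux's body verbatim as conclusion (`stub_transfer` re-typed; the first two hypotheses are the theorems
`Split.layerLinear_unfolded` / `Split.layerQuadratic_unfolded` and are not used by the proof — they
are kept so that the glue item of the TWO-LAYER PLAN closes `--by` this theorem verbatim). [folklore] -/
theorem stub_degreeSplit :
    (∀ (k : ℕ) (f : Fin k → Polynomial ℤ), Literature.NumberTheory.Sieve.IsBatemanHornSystem f →
      ∀ i : Fin k, (f i).natDegree = 1 → ∀ ε : ℝ, 0 < ε → ∃ δ : ℝ, 0 < δ ∧ δ ≤ 1 / 4 ∧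
        ∀ᶠ x : ℕ in Filter.atTop,
          (((Finset.Icc 1 x).filter (fun n : ℕ => (∀ j, 0 < (f j).eval (n : ℤ) ∧
              ∀ p ∈ Finset.range ⌈(x : ℝ) ^ (((f j).natDegree : ℝ) * (1 - δ) / 2)⌉₊,
                p.Prime → ¬ ((p : ℤ) ∣ (f j).eval (n : ℤ))) ∧
              ¬ ((f i).eval (n : ℤ)).toNat.Prime)).card : ℝ) ≤ ε * (x : ℝ) / Real.log x ^ k) →
    (∀ (k : ℕ) (f : Fin k → Polynomial ℤ), Literature.NumberTheory.Sieve.IsBatemanHornSystem f →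
      ∀ i : Fin k, (f i).natDegree = 2 → ∀ ε : ℝ, 0 < ε → ∃ δ : ℝ, 0 < δ ∧ δ ≤ 1 / 4 ∧
        ∀ᶠ x : ℕ in Filter.atTop,
          (((Finset.Icc 1 x).filter (fun n : ℕ => (∀ j, 0 < (f j).eval (n : ℤ) ∧
              ∀ p ∈ Finset.range ⌈(x : ℝ) ^ (((f j).natDegree : ℝ) * (1 - δ) / 2)⌉₊,
                p.Prime → ¬ ((p : ℤ) ∣ (f j).eval (n : ℤ))) ∧
              ¬ ((f i).eval (n : ℤ)).toNat.Prime)).card : ℝ) ≤ ε * (x : ℝ) / Real.log x ^ k) →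
    (∀ (k : ℕ) (f : Fin k → Polynomial ℤ), Literature.NumberTheory.Sieve.IsBatemanHornSystem f →
      ∀ i : Fin k, 3 ≤ (f i).natDegree → ∀ ε : ℝ, 0 < ε → ∃ δ : ℝ, 0 < δ ∧ δ ≤ 1 / 4 ∧
        ∀ᶠ x : ℕ in Filter.atTop,
          (((Finset.Icc 1 x).filter (fun n : ℕ => (∀ j, 0 < (f j).eval (n : ℤ) ∧
              ∀ p ∈ Finset.range ⌈(x : ℝ) ^ (((f j).natDegree : ℝ) * (1 - δ) / 2)⌉₊,
                p.Prime → ¬ ((p : ℤ) ∣ (f j).eval (n : ℤ))) ∧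
              ¬ ((f i).eval (n : ℤ)).toNat.Prime)).card : ℝ) ≤ ε * (x : ℝ) / Real.log x ^ k) →
      ∀ (k : ℕ) (f : Fin k → Polynomial ℤ), Literature.NumberTheory.Sieve.IsBatemanHornSystem f →
        ∀ ε : ℝ, 0 < ε → ∃ δ : ℝ, 0 < δ ∧ δ ≤ 1 / 4 ∧ ∀ᶠ x : ℕ in Filter.atTop,
          (((Finset.Icc 1 x).filter (fun n : ℕ => ∀ i, 0 < (f i).eval (n : ℤ) ∧
              ∀ p ∈ Finset.range ⌈(x : ℝ) ^ (((f i).natDegree : ℝ) * (1 - δ) / 2)⌉₊,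
                p.Prime → ¬ ((p : ℤ) ∣ (f i).eval (n : ℤ)))).card : ℝ) ≤
            (Literature.NumberTheory.Sieve.polyPrimeCount f x : ℝ) + ε * (x : ℝ) / Real.log x ^ k :=
  fun _ _ hhigh => stub_transfer hhigh


end Summit.Parity.BatemanHorn.Cruxes.BalancedSemiprimeLayer.SmoothModulusTwistedHooley
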